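import Literature.NumberTheory.EllipticCurves.CasselsTateGeneralCaseKernel
import Literature.NumberTheory.EllipticCurves.ArchimedeanWeilPairingDuality
import Literature.NumberTheory.GaloisCohomology.PairingTateDual
import Literature.NumberTheory.GaloisRepresentations.LocalDualityDescent
import Literature.NumberTheory.GaloisRepresentations.LocalGlobalCohomologyFiniteProofs
import Literature.NumberTheory.GaloisRepresentations.IdeleTorusHasseCovariant
import Summits.BirchSwinnertonDyer.BirchSwinnertonDyer.Theorems.SchneiderFreeAdditiveX3PoitouTateShaTwoLocalGlobalReal
import Summits.BirchSwinnertonDyer.BirchSwinnertonDyer.Theorems.ThetaPartnerAtTwoSignedControlAtTwoShaTwoNativeAssemblyReal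
import HarnessLib

/-!
# The Ш²-cochain bridge, opening of the assembly: the dual map `θ : E[m] → E[m]^D` of the descended Weil pairing is an
# ISOMORPHISM of Galois modules (so `H²(θ)` is injective), a `2`-cocycle with local primitives has class in `Ш²`, and
# `θ_* [f] ∈ Ш²(K, E[m]^D)` is EXHAUSTED by cell bsd-schneider's obstruction map `Ψ = shaTwoConnecting` at EVERY number field

Route `SemiOrdinaryEisensteinDescent` (BSD, rung W-ALL row 2·3@3), Kolyvagin column, Cassels–Tate lane: print item
`CasselsTateLevelInputsFact` (stmt-BirchSwinnertonDyer-20191).  After w3 g6 (p628097,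
`CasselsTateConj.casselsTate_levelInputs_of_shaTwoCochain`) its one remaining input for THE canonical invariant maps is `hPTc`
(Milne I Thm. 4.10 (a) for `Ш²(K, E[m])` in the `PTChoice` cochain form).  The bridge from the obstruction map
`Ψ = HomDual.shaTwoConnecting` to that cochain form is the memo `Cruxes/WildKolyvaginUpperAtThree/SHA2-BRIDGE-w3g7.md` (width seat
w3 g7: steps S1 ✓, S2a ✓, S2b, S3a, S3b, S4).  THIS FILE is the OPENING of step S4 — memo §1 (i) and (ii) — written so that
the assembly can consume it by name (width seat `bsd-wall-soed-p2-w4` g2; `--supports stmt-BirchSwinnertonDyer-20480`,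
helper; route-free, no `Theses` import):

* §1 (generic, any field) `galoisCohomology_map_bijective_of_bijective` — a BIJECTIVE intertwining map of discrete Galois
  modules induces bijections on every `Hⁱ` (it is an isomorphism of `TopRep`: `topRepIsoOfEquiv`,
  `continuousCohomologyEquivOfIso`); `pairingDualHom_injective_of_flip_injective` /
  `pairingDualHom_bijective_of_flip_injective` — the dual map `B^♭ : M → M^D = Hom(M, μₙ)` of a `μₙ`-valued pairing on a
  finite `n`-torsion `M` that is non-degenerate on the right is bijective (`#M^D = #M`, `HomCarrier.natCard_eq`);
* §2 (the descended Weil pairing `desc : E[m] × E[m] → μ_{m²}` of `WeilPairingLevelDescent`) `descDualHom_bijective` —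
  **`θ : T ↦ desc(·, T)`, `E[m] → E[m]^D`, is bijective** for `e` right-non-degenerate (`descendHom_flip_injective`), and so is
  the flipped `S ↦ desc(S, ·)` for `e` alternating (`descendHom_injective`); hence
  `galoisCohomology_map_descDual_bijective` (every degree) and **`twoCocycleClass_eq_zero_iff_map_descDual`:
  `[f] = 0 ↔ θ_* [f] = 0`** — memo §1 (i) and the last line of (vii);
* §3 (over a number field) `twoCocycleClass_mem_shaTwo_of_localPrimitives` — a `2`-cocycle admitting a local primitive at
  every place has class in `Ш²`; in particular **`PTChoice.twoCocycleClass_mem_shaTwo`** (the `φ_v` of any admissible choice);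
  the converse `exists_localPrimitives_of_mem_shaTwo`; the dictionary `oneCocycleClass_mem_sha_iff_locClass` between the
  local-triviality binder of `hPTc` and `Ш¹`; `map_descDual_twoCocycleClass_mem_shaTwo` — `θ_* [f] ∈ Ш²(K, E[m]^D)`;
* §4 **`PTChoice.exists_shaTwoConnecting_eq_map_descDual`** — memo §1 (ii) EXHAUSTION at EVERY number field `K`:
  `∃ h ∈ Hom_Γ(N₁, C̄), Ψ h = θ_* [f]` (Milne I Lemma 4.13 in the tree's form
  `IdeleReadout.exists_shaTwoConnecting_eq_of_localGlobalTwo`, hypothesis (A) := door-c4 g19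
  `PoitouTateShaTwoReadout.tateDual_localGlobal_real`, (B) := `sha_hom_units_dies_in_idele` plugged there); and the
  reduction `PTChoice.twoCocycleClass_eq_zero_of_shaTwoConnecting_eq_zero`: **`hPTc`'s conclusion `[f] = 0` follows once
  that `h` has `Ψ h = 0`** — which is what S2–S3 (the explicit admissible choice and its invariant sum) deliver.

THEOREMS ONLY (no definition, no instance, no named fact introduced).  Nothing here proves a case of BSD; Poitou–Tate /
Cassels–Tate are published theorems being discharged in the kernel; the exhaustion (e) is CONSUMED by name from cells
bsd-schneider / bsd-wall (door-c4·c5, chl-p2, k4-p1), not re-derived.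

## References
* [MilneADT2006] J. S. Milne, *Arithmetic Duality Theorems*, 2nd ed. (2006), Ch. I §0 (pairings, `M^D`), Cor. 2.3, Thm. 4.10 (a)
  and its proof (p. 58), Lemma 4.13; §6 proof of Prop. 6.9 (the descended pairing `E[m] × E[m] → μ_{m²}`).
* [SilvermanAEC2009] J. H. Silverman, *The Arithmetic of Elliptic Curves*, 2nd ed. (2009), Prop. III.8.1 (Weil pairing:
  bilinear, alternating, non-degenerate, Galois-equivariant), Cor. III.6.4.
* [NeukirchSchmidtWingberg2008] J. Neukirch, A. Schmidt, K. Wingberg, *Cohomology of Number Fields* (2008), I §2–§3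
  (functoriality of cohomology on cochains; isomorphic coefficient modules).
* [SerreGaloisCohomology1997] J.-P. Serre, *Galois Cohomology* (1997), I §2.3 (classes of continuous `2`-cocycles).
-/

noncomputable section

open scoped Classical

universe u

-- `Summit.<P>.<Sub>` repeats `BirchSwinnertonDyer` by the tree's layout convention (D-0017)
set_option linter.dupNamespace false
set_option autoImplicit false

namespace Summit.BirchSwinnertonDyer.BirchSwinnertonDyer.Theorems.ShaTwoCochainTheta

open CategoryTheory _root_.WeierstrassCurve Field Function NumberField
open Literature.NumberTheory.EllipticCurves
open Literature.NumberTheory.GaloisRepresentations Literature.NumberTheory.GaloisCohomology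
open Literature.NumberTheory.GaloisRepresentations.DiscreteGaloisModule (mu MuCarrier pairing TateDual tateDual
  pairingDualHom pairingDualIntertwining sha shaTwo)
open scoped ContRepresentation

/-! ## §1 Generic: bijective intertwining maps on cohomology; the dual map of a right-non-degenerate pairing -/

section Generic

variable {K : Type u} [Field K]
variable {M₁ M₂ : Type u} [AddCommGroup M₁] [TopologicalSpace M₁] [DiscreteTopology M₁]
  [AddCommGroup M₂] [TopologicalSpace M₂] [DiscreteTopology M₂]
  {ρ₁ : DiscreteGaloisModule K M₁} {ρ₂ : DiscreteGaloisModule K M₂}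

/-- **A bijective intertwining map of discrete Galois modules induces a bijection on every `Hⁱ(K, –)`**: its inverse is
automatically continuous and equivariant, so it is an isomorphism of topological representations (`topRepIsoOfEquiv`), and
`continuousCohomologyEquivOfIso` applies; `galoisCohomology.map` is that isomorphism's `cohomologyMap` by `rfl`.
[cite: MilneADT2006, Ch. I §0] [cite: NeukirchSchmidtWingberg2008, I §3] -/
theorem galoisCohomology_map_bijective_of_bijective (u : ρ₁.toContRepresentation →ⁱL ρ₂.toContRepresentation)
    (hu : Bijective u) (q : ℕ) : Bijective (galoisCohomology.map u q) := by
  haveI : DiscreteTopology ρ₁.toTopRep := inferInstanceAs (DiscreteTopology M₁)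
  haveI : DiscreteTopology ρ₂.toTopRep := inferInstanceAs (DiscreteTopology M₂)
  let e : ρ₁.toTopRep ≃L[ℤ] ρ₂.toTopRep :=
    { (LinearEquiv.ofBijective u.toContinuousLinearMap.toLinearMap hu) with
      continuous_toFun := continuous_of_discreteTopology
      continuous_invFun := continuous_of_discreteTopology }
  have he : ∀ (g : absoluteGaloisGroup K) (x : ρ₁.toTopRep), e (ρ₁.toTopRep.ρ g x) = ρ₂.toTopRep.ρ g (e x) :=
    fun g x => congr($(u.isIntertwining' g) x)
  have hhom : galoisCohomology.map u q = (cohomologyMap (topRepIsoOfEquiv e he).hom q).hom.toLinearMap.toAddMonoidHom :=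
    rfl
  rw [hhom]
  exact (continuousCohomologyEquivOfIso (topRepIsoOfEquiv e he) q).bijective

/-- For a bijective intertwining map `u`, `u_* c = 0 ↔ c = 0` on `Hⁱ`. [cite: MilneADT2006, Ch. I §0] -/
theorem galoisCohomology_map_eq_zero_iff_of_bijective (u : ρ₁.toContRepresentation →ⁱL ρ₂.toContRepresentation)
    (hu : Bijective u) (q : ℕ) (c : galoisCohomology ρ₁ q) : galoisCohomology.map u q c = 0 ↔ c = 0 :=
  ⟨fun h => (galoisCohomology_map_bijective_of_bijective u hu q).1 (h.trans (map_zero _).symm), fun h => by rw [h, map_zero]⟩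

variable (n : ℕ)

omit [TopologicalSpace M₁] [DiscreteTopology M₁] [TopologicalSpace M₂] [DiscreteTopology M₂] in
/-- **The dual map `B^♭ : M₂ → M₁^D`, `y ↦ B(·, y)`, of a pairing `B : M₁ × M₂ → μₙ` is injective when `B` is non-degenerate
on the right** (`B(·, y) = 0 ⇒ y = 0`, i.e. `B.flip` injective) — `pairingDualHom n B y` IS `B.flip y`. [cite: MilneADT2006, Ch. I §0] -/
theorem pairingDualHom_injective_of_flip_injective (B : M₁ →+ M₂ →+ MuCarrier K n) (hB : Injective B.flip) :
    Injective (pairingDualHom (K := K) n B) :=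
  fun _ _ h => hB (AddMonoidHom.ext fun x => DFunLike.congr_fun h x)

variable {M : Type u} [AddCommGroup M] [TopologicalSpace M] [DiscreteTopology M]

omit [TopologicalSpace M] [DiscreteTopology M] in
/-- **For a finite `n`-torsion `M` (`n ≥ 1`, `char K = 0`) a right-non-degenerate pairing `B : M × M → μₙ` has BIJECTIVE dual map
`B^♭ : M → M^D = Hom(M, μₙ)`**: injective between finite sets of the same size, `#Hom(M, μₙ(K̄)) = #M`
(`HomCarrier.natCard_eq` with `μₙ(K̄) ≃ ℤ/n`, `muEquivZMod`). [cite: MilneADT2006, Ch. I §0, Cor. 2.3] -/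
theorem pairingDualHom_bijective_of_flip_injective [CharZero K] [Finite M] [NeZero n] (hM : ∀ x : M, n • x = 0)
    (B : M →+ M →+ MuCarrier K n) (hB : Injective B.flip) : Bijective (pairingDualHom (K := K) n B) := by
  haveI : Finite (TateDual K M n) := DiscreteGaloisModule.TateDual.finite K M n
  exact (pairingDualHom_injective_of_flip_injective n B hB).bijective_of_nat_card_le
    (le_of_eq (HomCarrier.natCard_eq (M := M) (muEquivZMod K n) hM))

/-- **`Hⁱ(B^♭)` is bijective when `B^♭` is** (for an equivariant pairing, `B^♭` packaged as the intertwining map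
`pairingDualIntertwining`). [cite: MilneADT2006, Ch. I §0, Cor. 2.3] -/
theorem galoisCohomology_map_pairingDualIntertwining_bijective [Finite M₁] {B : M₁ →+ M₂ →+ MuCarrier K n}
    (hB : ∀ (σ : absoluteGaloisGroup K) (x : M₁) (y : M₂), B (ρ₁ σ x) (ρ₂ σ y) = mu K n σ (B x y))
    (hbij : Bijective (pairingDualHom (K := K) n B)) (q : ℕ) :
    Bijective (galoisCohomology.map (pairingDualIntertwining hB) q) :=
  galoisCohomology_map_bijective_of_bijective (pairingDualIntertwining hB) hbij q

end Generic

/-! ## §2 The dual map `θ` of the descended Weil pairing `desc : E[m] × E[m] → μ_{m²}` -/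

section Desc

variable {K : Type u} [Field K] [CharZero K] (W : WeierstrassCurve K) (m : ℕ) [NeZero m]
variable (e : geomTorsion W ((m * m : ℕ) : ℤ) → geomTorsion W ((m * m : ℕ) : ℤ) → AlgebraicClosure K)
  (hμ : ∀ S T, e S T ^ (m * m) = 1)
  (hadd₁ : ∀ S₁ S₂ T, e (S₁ + S₂) T = e S₁ T * e S₂ T)
  (hadd₂ : ∀ S T₁ T₂, e S (T₁ + T₂) = e S T₁ * e S T₂)

/-- **`θ : T ↦ desc(·, T)`, `E[m] → E[m]^D = Hom(E[m], μ_{m²})`, is injective** for `e` non-degenerate on the right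
(`descendHom_flip_injective`: `desc(S, T) = e(S', ι T)` for `[m] S' = S`). [cite: MilneADT2006, Ch. I §6, proof of Prop. 6.9]
[cite: SilvermanAEC2009, Prop. III.8.1 (c), (e)] -/
theorem descDualHom_injective (hnd : ∀ T, (∀ S, e S T = 1) → T = 0) :
    Injective (pairingDualHom (K := K) (m * m) (descendHom W m m e hμ hadd₁ hadd₂)) :=
  pairingDualHom_injective_of_flip_injective (m * m) _ (descendHom_flip_injective W m m e hμ hadd₁ hadd₂ hnd)

/-- **`θ : E[m] → E[m]^D` is BIJECTIVE** for `E[m]` finite (e.g. `W` elliptic, `finite_geomTorsion_of_neZero`) and `e`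
non-degenerate on the right: injective, and `#Hom(E[m], μ_{m²}) = #E[m]` (`E[m]` killed by `m²`,
`FirstCaseData.mul_nsmul_geomTorsion_eq_zero`). — memo SHA2-BRIDGE §1 (i).
[cite: MilneADT2006, Ch. I §6, proof of Prop. 6.9; Cor. 2.3] [cite: SilvermanAEC2009, Prop. III.8.1, Cor. III.6.4] -/
theorem descDualHom_bijective [Finite (geomTorsion W (m : ℤ))] (hnd : ∀ T, (∀ S, e S T = 1) → T = 0) :
    Bijective (pairingDualHom (K := K) (m * m) (descendHom W m m e hμ hadd₁ hadd₂)) := by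
  haveI : NeZero (m * m) := ⟨mul_ne_zero (NeZero.ne m) (NeZero.ne m)⟩
  exact pairingDualHom_bijective_of_flip_injective (m * m) (FirstCaseData.mul_nsmul_geomTorsion_eq_zero (W := W) (m := m)) _
    (descendHom_flip_injective W m m e hμ hadd₁ hadd₂ hnd)

/-- **The flipped dual map `S ↦ desc(S, ·)` is injective** for `e` alternating and non-degenerate (`descendHom_injective`).
[cite: MilneADT2006, Ch. I §6, proof of Prop. 6.9] [cite: SilvermanAEC2009, Prop. III.8.1] -/
theorem descDualHom_flip_injective (halt : ∀ T, e T T = 1) (hnd : ∀ T, (∀ S, e S T = 1) → T = 0) :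
    Injective (pairingDualHom (K := K) (m * m) (descendHom W m m e hμ hadd₁ hadd₂).flip) :=
  pairingDualHom_injective_of_flip_injective (m * m) _
    ((injective_iff_map_eq_zero _).2 fun S hS =>
      (injective_iff_map_eq_zero _).1 (descendHom_injective W m m e hμ hadd₁ hadd₂ halt hnd) S
        (AddMonoidHom.ext fun T => DFunLike.congr_fun hS T))

/-- **The flipped dual map `S ↦ desc(S, ·)`, `E[m] → E[m]^D`, is bijective** (`E[m]` finite, `e` alternating and
non-degenerate). [cite: MilneADT2006, Ch. I §6, proof of Prop. 6.9; Cor. 2.3] [cite: SilvermanAEC2009, Prop. III.8.1] -/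
theorem descDualHom_flip_bijective [Finite (geomTorsion W (m : ℤ))] (halt : ∀ T, e T T = 1) (hnd : ∀ T, (∀ S, e S T = 1) → T = 0) :
    Bijective (pairingDualHom (K := K) (m * m) (descendHom W m m e hμ hadd₁ hadd₂).flip) := by
  haveI : NeZero (m * m) := ⟨mul_ne_zero (NeZero.ne m) (NeZero.ne m)⟩
  exact pairingDualHom_bijective_of_flip_injective (m * m) (FirstCaseData.mul_nsmul_geomTorsion_eq_zero (W := W) (m := m)) _
    ((injective_iff_map_eq_zero _).2 fun S hS =>
      (injective_iff_map_eq_zero _).1 (descendHom_injective W m m e hμ hadd₁ hadd₂ halt hnd) S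
        (AddMonoidHom.ext fun T => DFunLike.congr_fun hS T))

variable (hgal : ∀ (σ : absoluteGaloisGroup K) (S T : geomTorsion W ((m * m : ℕ) : ℤ)), σ • e S T = e (σ • S) (σ • T))

include hgal in
/-- The flipped descended pairing is `Γ_K`-equivariant (the equivariance `descendHom_smul`, arguments swapped), in the
binder shape of `pairingDualIntertwining`. [folklore] -/
theorem descendHom_flip_smul (σ : absoluteGaloisGroup K) (T S : geomTorsion W (m : ℤ)) :
    (descendHom W m m e hμ hadd₁ hadd₂).flip ((W.torsionGaloisModule (m : ℤ)) σ T) ((W.torsionGaloisModule (m : ℤ)) σ S) =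
      mu K (m * m) σ ((descendHom W m m e hμ hadd₁ hadd₂).flip T S) :=
  descendHom_smul W m m e hμ hadd₁ hadd₂ hgal σ S T

/-- **`Hⁱ(θ) : Hⁱ(K, E[m]) → Hⁱ(K, E[m]^D)` is bijective in every degree** (`θ = desc^♭` an isomorphism of Galois modules).
[cite: MilneADT2006, Ch. I §0, Cor. 2.3; §6 proof of Prop. 6.9] -/
theorem galoisCohomology_map_descDual_bijective [Finite (geomTorsion W (m : ℤ))] (hnd : ∀ T, (∀ S, e S T = 1) → T = 0) (q : ℕ) :
    Bijective (galoisCohomology.map (pairingDualIntertwining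
      (ρ₁ := W.torsionGaloisModule (m : ℤ)) (ρ₂ := W.torsionGaloisModule (m : ℤ))
      (B := descendHom W m m e hμ hadd₁ hadd₂) (descendHom_smul W m m e hμ hadd₁ hadd₂ hgal)) q) :=
  galoisCohomology_map_pairingDualIntertwining_bijective (m * m) _ (descDualHom_bijective W m e hμ hadd₁ hadd₂ hnd) q

/-- The same for the flipped dual map `S ↦ desc(S, ·)` (`e` alternating and non-degenerate). [cite: MilneADT2006, Ch. I §0, Cor. 2.3] -/
theorem galoisCohomology_map_descDual_flip_bijective [Finite (geomTorsion W (m : ℤ))] (halt : ∀ T, e T T = 1)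
    (hnd : ∀ T, (∀ S, e S T = 1) → T = 0) (q : ℕ) :
    Bijective (galoisCohomology.map (pairingDualIntertwining
      (ρ₁ := W.torsionGaloisModule (m : ℤ)) (ρ₂ := W.torsionGaloisModule (m : ℤ))
      (B := (descendHom W m m e hμ hadd₁ hadd₂).flip) (descendHom_flip_smul W m e hμ hadd₁ hadd₂ hgal)) q) :=
  galoisCohomology_map_pairingDualIntertwining_bijective (m * m) _
    (descDualHom_flip_bijective W m e hμ hadd₁ hadd₂ halt hnd) q

/-- **`[f] = 0 ↔ θ_* [f] = 0` in `H²`** — the last line of memo §1 (vii): once `θ_* c = Ψ h = 0` is known, `c = 0`.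
[cite: MilneADT2006, Ch. I Thm. 4.10 (a), proof p. 58; Cor. 2.3] -/
theorem twoCocycleClass_eq_zero_iff_map_descDual [Finite (geomTorsion W (m : ℤ))] (hnd : ∀ T, (∀ S, e S T = 1) → T = 0)
    (f : contTwoCocycles (W.torsionGaloisModule (m : ℤ)).toTopRep) :
    twoCocycleClass _ f = 0 ↔
      galoisCohomology.map (pairingDualIntertwining
        (ρ₁ := W.torsionGaloisModule (m : ℤ)) (ρ₂ := W.torsionGaloisModule (m : ℤ))
        (B := descendHom W m m e hμ hadd₁ hadd₂) (descendHom_smul W m m e hμ hadd₁ hadd₂ hgal)) 2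
        (twoCocycleClass _ f) = 0 :=
  (galoisCohomology_map_eq_zero_iff_of_bijective (pairingDualIntertwining
    (ρ₁ := W.torsionGaloisModule (m : ℤ)) (ρ₂ := W.torsionGaloisModule (m : ℤ))
    (B := descendHom W m m e hμ hadd₁ hadd₂) (descendHom_smul W m m e hμ hadd₁ hadd₂ hgal))
    (descDualHom_bijective W m e hμ hadd₁ hadd₂ hnd) 2 (twoCocycleClass _ f)).symm

end Desc

/-! ## §3 Over a number field: local primitives ⟺ `Ш²`; the `Ш¹` dictionary; `θ_*` preserves `Ш²` -/

section Sha

variable {K : Type u} [Field K] [NumberField K]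
variable {M : Type u} [AddCommGroup M] [TopologicalSpace M] [DiscreteTopology M] (ρ : DiscreteGaloisModule K M)

/-- **A `2`-cocycle admitting a continuous local primitive at every place has class in `Ш²(K, M)`**:
`loc_v [f] = [res_v f]` (`locClass₂_resTwo`) and `[res_v f] = 0` by `twoCocycleClass_eq_zero_iff`.
[cite: MilneADT2006, Ch. I §4 (definition of `Ш²`)] [cite: SerreGaloisCohomology1997, I §2.3] -/
theorem twoCocycleClass_mem_shaTwo_of_localPrimitives (f : contTwoCocycles ρ.toTopRep)
    (φ : (v : Place K) → C(absoluteGaloisGroup (Place.Completion v), M))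
    (hφ : ∀ (v : Place K) (σ τ : absoluteGaloisGroup (Place.Completion v)),
      (resTwo ρ (Place.Completion v) f).1 (σ, τ) = ρ (absGaloisRestrict K (Place.Completion v) σ) (φ v τ) - φ v (σ * τ) + φ v σ) :
    twoCocycleClass _ f ∈ shaTwo ρ := by
  refine (DiscreteGaloisModule.mem_shaTwo_iff ρ (twoCocycleClass _ f)).2 fun v => ?_
  haveI := absoluteGaloisGroup_compactSpace (Place.Completion v)
  change galoisCohomology.res ρ (Place.Completion v) 2 (twoCocycleClass _ f) = 0
  rw [← locClass₂_resTwo, locClass₂_eq]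
  exact (twoCocycleClass_eq_zero_iff _ _).2 ⟨φ v, hφ v⟩

/-- **Conversely, a class in `Ш²(K, M)` has a continuous local primitive at every place.** [cite: MilneADT2006, Ch. I §4]
[cite: SerreGaloisCohomology1997, I §2.3] -/
theorem exists_localPrimitives_of_mem_shaTwo (f : contTwoCocycles ρ.toTopRep) (hf : twoCocycleClass _ f ∈ shaTwo ρ)
    (v : Place K) :
    ∃ φ : C(absoluteGaloisGroup (Place.Completion v), M), ∀ σ τ : absoluteGaloisGroup (Place.Completion v),
      (resTwo ρ (Place.Completion v) f).1 (σ, τ) = ρ (absGaloisRestrict K (Place.Completion v) σ) (φ τ) - φ (σ * τ) + φ σ := by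
  haveI := absoluteGaloisGroup_compactSpace (Place.Completion v)
  have h : galoisCohomology.res ρ (Place.Completion v) 2 (twoCocycleClass _ f) = 0 :=
    (DiscreteGaloisModule.mem_shaTwo_iff ρ _).1 hf v
  rw [← locClass₂_resTwo, locClass₂_eq] at h
  exact (twoCocycleClass_eq_zero_iff _ _).1 h

/-- **The `Ш¹` dictionary**: the local-triviality binder of `hPTc` ("`[res_v g] = 0` at every place", `locClass`/`resOne` form) is
membership of `[g]` in `Ш¹(K, M)` (`locClass_resOne`; `localization` is `res` at the completion by `rfl`).
[cite: MilneADT2006, Ch. I §4 (definition of `Ш¹`)] -/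
theorem oneCocycleClass_mem_sha_iff_locClass (g : contOneCocycles ρ.toTopRep) :
    oneCocycleClass _ g ∈ sha ρ ↔ ∀ v : Place K, locClass ρ (Place.Completion v) (resOne ρ (Place.Completion v) g) = 0 := by
  refine (DiscreteGaloisModule.mem_sha_iff ρ (oneCocycleClass _ g)).trans (forall_congr' fun v => ?_)
  rw [locClass_resOne]
  rfl

end Sha

section DescSha

variable {K : Type} [Field K] [NumberField K] {W : WeierstrassCurve K} {m : ℕ} [NeZero m]
variable {e : geomTorsion W ((m * m : ℕ) : ℤ) → geomTorsion W ((m * m : ℕ) : ℤ) → AlgebraicClosure K}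
  {hμ : ∀ S T, e S T ^ (m * m) = 1}
  {hadd₁ : ∀ S₁ S₂ T, e (S₁ + S₂) T = e S₁ T * e S₂ T}
  {hadd₂ : ∀ S T₁ T₂, e S (T₁ + T₂) = e S T₁ * e S T₂}
  {hgal : ∀ (σ : absoluteGaloisGroup K) (S T : geomTorsion W ((m * m : ℕ) : ℤ)), σ • e S T = e (σ • S) (σ • T)}


/-- **The local primitives `φ_v` of an admissible choice put `[f]` in `Ш²(K, E[m])`** (`PTChoice.dOne_φ`). In `hPTc` the
hypothesis at the locally trivial `g = 0` supplies such a choice, so the `2`-cocycle `f` there is a `Ш²`-cocycle.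
[cite: MilneADT2006, Ch. I §4 Thm. 4.10 (a); §6 proof of Thm. 6.13 (a), p. 88] -/
theorem _root_.Literature.NumberTheory.EllipticCurves.PTChoice.twoCocycleClass_mem_shaTwo
    {f : contTwoCocycles (W.torsionGaloisModule (m : ℤ)).toTopRep} {g : contOneCocycles (W.torsionGaloisModule (m : ℤ)).toTopRep}
    (C : PTChoice W m e hμ hadd₁ hadd₂ hgal f g) :
    twoCocycleClass _ f ∈ shaTwo (W.torsionGaloisModule (m : ℤ)) :=
  twoCocycleClass_mem_shaTwo_of_localPrimitives _ f (fun v => C.φ v) fun v σ τ => C.dOne_φ v σ τ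

/-- **`θ_* [f] ∈ Ш²(K, E[m]^D)`** for a `2`-cocycle `f` of `E[m]` with an admissible choice (`H²(θ)` preserves `Ш²` at ANY number
field: `PoitouTateShaTwoReadout.map_mem_shaTwo_real`). [cite: MilneADT2006, Ch. I §4 Thm. 4.10 (a)] -/
theorem _root_.Literature.NumberTheory.EllipticCurves.PTChoice.map_descDual_twoCocycleClass_mem_shaTwo [Finite (geomTorsion W (m : ℤ))]
    {f : contTwoCocycles (W.torsionGaloisModule (m : ℤ)).toTopRep} {g : contOneCocycles (W.torsionGaloisModule (m : ℤ)).toTopRep}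
    (C : PTChoice W m e hμ hadd₁ hadd₂ hgal f g) :
    galoisCohomology.map (pairingDualIntertwining
        (ρ₁ := W.torsionGaloisModule (m : ℤ)) (ρ₂ := W.torsionGaloisModule (m : ℤ))
        (B := descendHom W m m e hμ hadd₁ hadd₂) (descendHom_smul W m m e hμ hadd₁ hadd₂ hgal)) 2
      (twoCocycleClass _ f) ∈ shaTwo ((W.torsionGaloisModule (m : ℤ)).tateDual (m * m)) :=
  PoitouTateShaTwoReadout.map_mem_shaTwo_real (pairingDualIntertwining
    (ρ₁ := W.torsionGaloisModule (m : ℤ)) (ρ₂ := W.torsionGaloisModule (m : ℤ))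
    (B := descendHom W m m e hμ hadd₁ hadd₂) (descendHom_smul W m m e hμ hadd₁ hadd₂ hgal)) C.twoCocycleClass_mem_shaTwo

/-! ## §4 Exhaustion: `θ_* [f] = Ψ h` at every number field, and the reduction of `hPTc` to `Ψ h = 0` -/

open Literature.NumberTheory.GaloisRepresentations.HomDual (shaTwoConnecting)
open Literature.NumberTheory.GaloisRepresentations.FreePresentation (presentationComplex)
open Literature.NumberTheory.GaloisRepresentations.IdeleClassBar (classBarD)
open Literature.NumberTheory.GaloisRepresentations.IdeleReadout (exists_shaTwoConnecting_eq_of_localGlobalTwo)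

/-- **EXHAUSTION (memo SHA2-BRIDGE §1 (ii)) at EVERY number field `K`.**  For `W/K` with `E[m]` finite (e.g. elliptic), `m ≥ 1`, a Weil-type `e` on
`E[m²]` and a `2`-cocycle `f` of `E[m]` carrying an admissible choice `(h; φ_v)` against some `g` (in `hPTc`: against
`g = 0`), the class `θ_* [f] ∈ Ш²(K, E[m]^D)` is `Ψ h` for some `Γ_K`-equivariant `h : N₁ → C̄` — cell bsd-schneider's
obstruction map `Ψ = shaTwoConnecting` of the canonical presentation `0 → N₁ → P → E[m] → 0` EXHAUSTS `Ш²(K, E[m]^D)`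
(Milne I Lemma 4.13 in the tree's form `exists_shaTwoConnecting_eq_of_localGlobalTwo`, with (A) := door-c4 g19's
`tateDual_localGlobal_real`, real places allowed). CONSUMED by name; nothing about Poitou–Tate is re-derived here.
[cite: MilneADT2006, Ch. I Thm. 4.10 (a), proof p. 58, Lemma 4.13] -/
theorem _root_.Literature.NumberTheory.EllipticCurves.PTChoice.exists_shaTwoConnecting_eq_map_descDual [Finite (geomTorsion W (m : ℤ))]
    {f : contTwoCocycles (W.torsionGaloisModule (m : ℤ)).toTopRep} {g : contOneCocycles (W.torsionGaloisModule (m : ℤ)).toTopRep}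
    (C : PTChoice W m e hμ hadd₁ hadd₂ hgal f g) [NeZero (m * m)]
    (hM : ∀ T : geomTorsion W (m : ℤ), (m * m) • T = 0) :
    ∃ h : (presentationComplex (W.torsionGaloisModule (m : ℤ))).X₁ ⟶ classBarD K,
      shaTwoConnecting (W.torsionGaloisModule (m : ℤ)) (m * m) hM h =
        galoisCohomology.map (pairingDualIntertwining
          (ρ₁ := W.torsionGaloisModule (m : ℤ)) (ρ₂ := W.torsionGaloisModule (m : ℤ))
          (B := descendHom W m m e hμ hadd₁ hadd₂) (descendHom_smul W m m e hμ hadd₁ hadd₂ hgal)) 2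
          (twoCocycleClass _ f) :=
  exists_shaTwoConnecting_eq_of_localGlobalTwo (W.torsionGaloisModule (m : ℤ)) (m * m) hM
    (PoitouTateShaTwoReadout.tateDual_localGlobal_real (W.torsionGaloisModule (m : ℤ)) (m * m) hM) _
    C.map_descDual_twoCocycleClass_mem_shaTwo

/-- **The reduction of `hPTc` to road B**: if the (any) `h` with `Ψ h = θ_* [f]` has `Ψ h = 0`, then `[f] = 0` (`H²(θ)`
injective, `twoCocycleClass_eq_zero_iff_map_descDual`).  Steps S2–S3 of the bridge show exactly that `Ψ h = 0` is forced
by `hPTc`'s vanishing hypothesis (the explicit admissible choice built from `h` and its invariant sum).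
[cite: MilneADT2006, Ch. I Thm. 4.10 (a), proof p. 58] -/
theorem _root_.Literature.NumberTheory.EllipticCurves.PTChoice.twoCocycleClass_eq_zero_of_shaTwoConnecting_eq_zero
    [Finite (geomTorsion W (m : ℤ))]
    {f : contTwoCocycles (W.torsionGaloisModule (m : ℤ)).toTopRep} {g : contOneCocycles (W.torsionGaloisModule (m : ℤ)).toTopRep}
    (C : PTChoice W m e hμ hadd₁ hadd₂ hgal f g) [NeZero (m * m)]
    (hM : ∀ T : geomTorsion W (m : ℤ), (m * m) • T = 0) (hnd : ∀ T, (∀ S, e S T = 1) → T = 0)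
    (hΨ : ∀ h : (presentationComplex (W.torsionGaloisModule (m : ℤ))).X₁ ⟶ classBarD K,
        shaTwoConnecting (W.torsionGaloisModule (m : ℤ)) (m * m) hM h =
          galoisCohomology.map (pairingDualIntertwining
            (ρ₁ := W.torsionGaloisModule (m : ℤ)) (ρ₂ := W.torsionGaloisModule (m : ℤ))
            (B := descendHom W m m e hμ hadd₁ hadd₂) (descendHom_smul W m m e hμ hadd₁ hadd₂ hgal)) 2
            (twoCocycleClass _ f) →
        shaTwoConnecting (W.torsionGaloisModule (m : ℤ)) (m * m) hM h = 0) :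
    twoCocycleClass _ f = 0 := by
  obtain ⟨h, hh⟩ := C.exists_shaTwoConnecting_eq_map_descDual hM
  rw [twoCocycleClass_eq_zero_iff_map_descDual W m e hμ hadd₁ hadd₂ hgal hnd f, ← hh]
  exact hΨ h hh

end DescSha

end Summit.BirchSwinnertonDyer.BirchSwinnertonDyer.Theorems.ShaTwoCochainTheta

end
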